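import Literature.AlgebraicGeometry.Motives.GrassmannianChartsCover
import Literature.RingTheory.FittingIdeal.SupportBaseChange
import Mathlib.LinearAlgebra.TensorProduct.Pi
import Mathlib.RingTheory.LocalRing.ResidueField.Ideal
import HarnessLib

/-!
# The standard chart is an OPEN CONDITION: `map f N ∈ chart x ⟺ Spec f lands in D(Ann coker (frame map))`

Topic `Literature/AlgebraicGeometry/Motives`; namespace `Literature.AlgebraicGeometry.Motives`, prefix `Grassmannian.`.  Sequel to
`GrassmannianCharts` (C1)(C2) and `GrassmannianChartsCover` (C2′)(C5), consuming B-p09 (g12)'s generic brick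
`Literature.RingTheory.FittingIdeal.SupportBaseChange` ((C3)) BY NAME; cell hodgecm-mathlib key (h4) (author B-p21 (g15),
partner B-p18 (g17)), deliverable (C3)-instantiation = ring side of (A3) «charts are open subfunctors».  THEOREMS ONLY.

For `N ∈ G(k, A ⊗ M; A)` and a frame `x : Fin k → M` let `C_x(N) := ((A ⊗ M)⧸N) ⧸ range (frameMap x N)` be the cokernel of the
frame map (a finite `A`-module).  Then for every `R`-algebra map `f : A → B`:

* `Grassmannian.frameMap_map` — the frame map of `map f N` is `(frameMap x N) ⊗_A B` up to the canonical equivalences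
  `Bᵏ ≅ B ⊗_A Aᵏ`, `(B ⊗ M)⧸(map f N) ≅ B ⊗_A ((A ⊗ M)⧸N)` (unconditional form of ★ `map_mem_chart`);
* `Grassmannian.surjective_frameMap_map_iff` — hence `frameMap x (map f N)` onto `⟺ (frameMap x N) ⊗_A B` onto;
* **`Grassmannian.map_mem_chart_iff_map_annihilator_eq_top`** — `map f N ∈ chart x B ⟺ Ann_A(C_x(N))·B = B`
  (also with `Fitt₀(C_x(N))`, whose generators are the `k × k` minors — the Plücker-coordinate form);
* **`Grassmannian.map_mem_chart_iff_range_comap_subset`** — `⟺ Spec B → Spec A` lands in the OPEN set `(Supp C_x(N))ᶜ = D(Ann C_x(N))`: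
  the chart is the open subfunctor cut out by `D(Ann C_x(N))` on every affine ([Stacks 089T]: «`U_I` is represented by the open
  `D(det of the I-minor)`»; EGA I 9.7.4);
* `Grassmannian.map_mem_chart_iff_ker_notMem_support` — at a field-valued point `f : A → K`: `map f N ∈ chart x K ⟺ ker f ∉ Supp C_x(N)`;
  `Grassmannian.setOf_map_residueField_mem_chart_eq`, `Grassmannian.isOpen_setOf_map_residueField_mem_chart` — the locus of primes
  `𝔭` with `N ⊗ κ(𝔭) ∈ chart x κ(𝔭)` is the open set `(Supp C_x(N))ᶜ`;
* `Grassmannian.iUnion_setOf_map_residueField_mem_chart` — these open sets, over all frames `x` drawn from a generating family of `M`,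
  COVER `Spec A` ((C5)).

HC_CM is proved only modulo the 7 printed citations until rung 0 closes; nothing here is about HC.

## References
* [StacksProject, Tag 089T] (the open subfunctors `U_I` and their cover); A. Grothendieck, EGA I (Springer 1971), §9.7.4;
  [EisenbudHarris2016, §3.2.2].
-/

set_option autoImplicit false

noncomputable section

universe u v w

open TensorProduct PrimeSpectrum Literature.RingTheory.FittingIdeal

namespace Literature.AlgebraicGeometry.Motives

namespace Grassmannian

variable {R : Type u} [CommRing R] {M : Type v} [AddCommGroup M] [Module R M] {k : ℕ}
variable {A : Type w} [CommRing A] [Algebra R A] {B : Type w} [CommRing B] [Algebra R B]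

/-! ## §1 The frame map of `map f N` is the base change of the frame map of `N` -/

/-- **The frame map of `map f N` is `(frameMap x N) ⊗_A B`** up to the canonical equivalences `Bᵏ ≅ B ⊗_A Aᵏ`
(Mathlib `TensorProduct.piScalarRight`) and `(B ⊗ M)⧸(map f N) ≅ B ⊗_A ((A ⊗ M)⧸N)` (Mathlib `baseChangeMkQEquiv`).
[cite: StacksProject, Tag 089T] -/
theorem frameMap_map (f : A →ₐ[R] B) (x : Fin k → M) (N : Module.Grassmannian A (A ⊗[R] M) k) :
    letI : Algebra A B := f.toAlgebra
    letI : IsScalarTower R A B := IsScalarTower.of_algHom f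
    frameMap x (Module.Grassmannian.map f N).toSubmodule =
      ((Submodule.quotEquivOfEq _ _ (Module.Grassmannian.map_toSubmodule f N)).trans
            (Module.Grassmannian.baseChangeMkQEquiv (B := B) N.toSubmodule)).symm.toLinearMap ∘ₗ
        (frameMap x N.toSubmodule).baseChange B ∘ₗ (TensorProduct.piScalarRight A B B (Fin k)).symm.toLinearMap := by
  classical
  letI : Algebra A B := f.toAlgebra
  letI : IsScalarTower R A B := IsScalarTower.of_algHom f
  refine (Pi.basisFun B (Fin k)).ext fun i => ?_
  rw [Pi.basisFun_apply, LinearMap.comp_apply, LinearMap.comp_apply, LinearEquiv.coe_toLinearMap,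
    LinearEquiv.coe_toLinearMap, LinearEquiv.eq_symm_apply, TensorProduct.piScalarRight_symm_single,
    LinearMap.baseChange_tmul, LinearEquiv.trans_apply]
  exact baseChangeMkQEquiv_frameMap_single f x N i

/-- **`frameMap x (map f N)` is onto iff `(frameMap x N) ⊗_A B` is onto.** [cite: StacksProject, Tag 089T] -/
theorem surjective_frameMap_map_iff (f : A →ₐ[R] B) (x : Fin k → M) (N : Module.Grassmannian A (A ⊗[R] M) k) :
    letI : Algebra A B := f.toAlgebra
    Function.Surjective (frameMap x (Module.Grassmannian.map f N).toSubmodule) ↔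
      Function.Surjective ((frameMap x N.toSubmodule).baseChange B) := by
  letI : Algebra A B := f.toAlgebra
  letI : IsScalarTower R A B := IsScalarTower.of_algHom f
  rw [frameMap_map f x N, LinearMap.coe_comp, LinearMap.coe_comp, LinearEquiv.coe_toLinearMap,
    LinearEquiv.coe_toLinearMap, Function.Surjective.of_comp_iff' (LinearEquiv.bijective _),
    Function.Surjective.of_comp_iff _ (LinearEquiv.surjective _)]

/-! ## §2 Membership of `map f N` in the chart is an open condition on `Spec A` -/

/-- **`map f N ∈ chart x B ⟺ Ann_A(coker frameMap x N)·B = B`** (B-p09's `LinearMap.surjective_baseChange_iff_map_annihilator_eq_top`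
at `g := frameMap x N`). [cite: StacksProject, Tag 089T] -/
theorem map_mem_chart_iff_map_annihilator_eq_top (f : A →ₐ[R] B) (x : Fin k → M) (N : Module.Grassmannian A (A ⊗[R] M) k) :
    Module.Grassmannian.map f N ∈ chart R M k x B ↔
      (Module.annihilator A (((A ⊗[R] M) ⧸ N.toSubmodule) ⧸ LinearMap.range (frameMap x N.toSubmodule))).map
          (f : A →+* B) = ⊤ := by
  letI : Algebra A B := f.toAlgebra
  rw [mem_chart_iff_surjective, surjective_frameMap_map_iff f x N]
  exact LinearMap.surjective_baseChange_iff_map_annihilator_eq_top (frameMap x N.toSubmodule) B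

/-- The same with the Fitting ideal `Fitt₀` of the cokernel (generated by the `k × k` minors of a presentation of the frame
map — the Plücker-type equations of the complement). [cite: StacksProject, Tag 089T] -/
theorem map_mem_chart_iff_map_fittingIdeal_eq_top (f : A →ₐ[R] B) (x : Fin k → M) (N : Module.Grassmannian A (A ⊗[R] M) k) :
    Module.Grassmannian.map f N ∈ chart R M k x B ↔
      (Module.fittingIdeal A (((A ⊗[R] M) ⧸ N.toSubmodule) ⧸ LinearMap.range (frameMap x N.toSubmodule)) 0).map
          (f : A →+* B) = ⊤ := by
  letI : Algebra A B := f.toAlgebra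
  rw [mem_chart_iff_surjective, surjective_frameMap_map_iff f x N]
  exact LinearMap.surjective_baseChange_iff_map_fittingIdeal_eq_top (frameMap x N.toSubmodule) B

/-- **THE CHART IS AN OPEN SUBFUNCTOR**: `map f N ∈ chart x B ⟺ Spec f : Spec B → Spec A` lands in the open subset
`(Supp_A coker frameMap x N)ᶜ = D(Ann coker)` of `Spec A`. [cite: StacksProject, Tag 089T] -/
theorem map_mem_chart_iff_range_comap_subset (f : A →ₐ[R] B) (x : Fin k → M) (N : Module.Grassmannian A (A ⊗[R] M) k) :
    Module.Grassmannian.map f N ∈ chart R M k x B ↔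
      Set.range (comap (f : A →+* B)) ⊆
        (Module.support A (((A ⊗[R] M) ⧸ N.toSubmodule) ⧸ LinearMap.range (frameMap x N.toSubmodule)))ᶜ := by
  letI : Algebra A B := f.toAlgebra
  rw [mem_chart_iff_surjective, surjective_frameMap_map_iff f x N]
  exact LinearMap.surjective_baseChange_iff_range_comap_subset (frameMap x N.toSubmodule) B

/-- The open subset is indeed open: `(Supp coker frameMap x N)ᶜ` is open in `Spec A` (the cokernel is a finite module).
[cite: StacksProject, Tag 089T] -/
theorem isOpen_compl_support_coker_frameMap (x : Fin k → M) (N : Module.Grassmannian A (A ⊗[R] M) k) :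
    IsOpen (Module.support A (((A ⊗[R] M) ⧸ N.toSubmodule) ⧸ LinearMap.range (frameMap x N.toSubmodule)))ᶜ :=
  (Module.isClosed_support (R := A) (M := ((A ⊗[R] M) ⧸ N.toSubmodule) ⧸ LinearMap.range (frameMap x N.toSubmodule))).isOpen_compl

/-! ## §3 Field-valued points: the chart locus `{𝔭 | N ⊗ κ(𝔭) ∈ chart x}` is the open set `(Supp coker)ᶜ` -/

/-- An ideal extends to the unit ideal along a map to a field iff it is not contained in the kernel (private helper).
[folklore] -/
private theorem ideal_map_eq_top_iff_not_le_ker {K : Type*} [Field K] (g : A →+* K) (I : Ideal A) :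
    I.map g = ⊤ ↔ ¬ I ≤ RingHom.ker g := by
  rw [← Ideal.map_eq_bot_iff_le_ker]
  constructor
  · intro h hbot
    exact bot_ne_top (hbot.symm.trans h)
  · intro h
    exact (Ideal.eq_bot_or_top (I.map g)).resolve_left h

/-- **At a field-valued point `f : A → K`: `map f N ∈ chart x K ⟺ ker f ∉ Supp_A(coker frameMap x N)`.**
[cite: StacksProject, Tag 089T] -/
theorem map_mem_chart_iff_ker_notMem_support {K : Type w} [Field K] [Algebra R K] (f : A →ₐ[R] K) (x : Fin k → M)
    (N : Module.Grassmannian A (A ⊗[R] M) k) :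
    Module.Grassmannian.map f N ∈ chart R M k x K ↔
      (⟨RingHom.ker (f : A →+* K), RingHom.ker_isPrime _⟩ : PrimeSpectrum A) ∉
        Module.support A (((A ⊗[R] M) ⧸ N.toSubmodule) ⧸ LinearMap.range (frameMap x N.toSubmodule)) := by
  rw [map_mem_chart_iff_map_annihilator_eq_top, ideal_map_eq_top_iff_not_le_ker, Module.mem_support_iff_of_finite]

/-- **The chart locus of `N` on `Spec A`**: the set of primes `𝔭` with `N ⊗ κ(𝔭) ∈ chart x κ(𝔭)` (base change along
`A → κ(𝔭)`) is `(Supp_A coker frameMap x N)ᶜ`. [cite: StacksProject, Tag 089T] -/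
theorem setOf_map_residueField_mem_chart_eq (x : Fin k → M) (N : Module.Grassmannian A (A ⊗[R] M) k) :
    {p : PrimeSpectrum A |
        Module.Grassmannian.map (IsScalarTower.toAlgHom R A p.asIdeal.ResidueField) N ∈ chart R M k x p.asIdeal.ResidueField} =
      (Module.support A (((A ⊗[R] M) ⧸ N.toSubmodule) ⧸ LinearMap.range (frameMap x N.toSubmodule)))ᶜ := by
  ext p
  rw [Set.mem_setOf_eq, map_mem_chart_iff_ker_notMem_support, Set.mem_compl_iff]
  have hp : (⟨RingHom.ker (IsScalarTower.toAlgHom R A p.asIdeal.ResidueField : A →+* p.asIdeal.ResidueField),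
      RingHom.ker_isPrime _⟩ : PrimeSpectrum A) = p :=
    PrimeSpectrum.ext (show RingHom.ker _ = p.asIdeal by
      rw [IsScalarTower.coe_toAlgHom]; exact Ideal.ker_algebraMap_residueField p.asIdeal)
  rw [hp]

/-- **The chart locus is open.** [cite: StacksProject, Tag 089T] -/
theorem isOpen_setOf_map_residueField_mem_chart (x : Fin k → M) (N : Module.Grassmannian A (A ⊗[R] M) k) :
    IsOpen {p : PrimeSpectrum A |
        Module.Grassmannian.map (IsScalarTower.toAlgHom R A p.asIdeal.ResidueField) N ∈ chart R M k x p.asIdeal.ResidueField} := by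
  rw [setOf_map_residueField_mem_chart_eq]
  exact isOpen_compl_support_coker_frameMap x N

/-- **The chart loci of the sub-frames of a generating family COVER `Spec A`** ((C5) at every residue field): for `g : J → M` with
`span (range g) = ⊤`, every prime `𝔭` lies in the chart locus of some `g ∘ I`, `I : Fin k → J` injective.
[cite: StacksProject, Tag 089T] [cite: EisenbudHarris2016, §3.2.2] -/
theorem iUnion_setOf_map_residueField_mem_chart {J : Type*} (g : J → M) (hg : Submodule.span R (Set.range g) = ⊤)
    (N : Module.Grassmannian A (A ⊗[R] M) k) :
    ⋃ I : {I : Fin k → J // Function.Injective I},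
        {p : PrimeSpectrum A | Module.Grassmannian.map (IsScalarTower.toAlgHom R A p.asIdeal.ResidueField) N ∈
          chart R M k (g ∘ I.1) p.asIdeal.ResidueField} = Set.univ := by
  refine Set.eq_univ_of_forall fun p => ?_
  obtain ⟨I, hI, hmem⟩ := exists_mem_chart_of_field (R := R) g hg
    (Module.Grassmannian.map (IsScalarTower.toAlgHom R A p.asIdeal.ResidueField) N)
  exact Set.mem_iUnion.2 ⟨⟨I, hI⟩, hmem⟩

end Grassmannian

end Literature.AlgebraicGeometry.Motives

end
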